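import Mathlib
import HarnessLib
import Summits.HubbardSuperconductivity.HubbardSuperconductivity.Theorems.KLProgrammePerturbedFermiCurveShiftedLevelTower
import Summits.HubbardSuperconductivity.HubbardSuperconductivity.Theorems.KLProgrammeKLRegimeSplitTwoLegF
import Summits.HubbardSuperconductivity.HubbardSuperconductivity.Theorems.KLProgrammeKLRegimeSplitFrameFn

/-!
# Route `KLProgramme` — the frame's 4-jet against the FREE radius at the SHIFTED level, PACKAGED: the tower on a level window and
# the three analytic inputs `hr`, `hlev`, `hjet` of the (C1) certificate consumer, verbatim

Cell `gate-hubbard-kl`, seat hubbard-kl-k3c3-p3 (g8; row «implicit-function / monotonicity route for μ(n)»); helper for the engine-flow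
child `KLRegimeEngineV17F2` (stmt-HubbardSuperconductivity-20437), stub (C) `stub_twoLeg_curvature`, (C1) certificate lane of k3c3-p1
(KL STATUS l.3453 (3), l.3483).  Companion of `…PerturbedFermiCurveShiftedLevelTower` (the pointwise orders 1–4 at a common point, no `A₀`):
* §3 `frame_shifted_tower_of_window` — inputs: the FREE band's numbers on `[a, b]` (`u ≤ U₀`, `|u^{(k)}| ≤ R_k`), the frame's per-order
  sizes `A₀ … A₄` (`2A₁ < Dt_min`, level `ν` with margins `A₀`), numbers `W₁ … W₄` dominating the closed forms (LINEAR in `A₁ … A₄` and the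
  lower widths; NO `A₀`); outputs at every angle: `ν′ ∈ [ν − A₀, ν + A₀] ∩ [a, b]`, `u_K(θ) = u_{ν′}(θ)` EXACTLY, the four jet differences
  `≤ W_k` and the frame's own tower `|u_K^{(k)}| ≤ R_k + W_k`;
* `frame_jets_sub_shiftedFree_le` — THE CONSUMER SHAPE: the three analytic hypotheses of k3c3-p1's
  `flowPiece_reading_remainder_jets_of_cert` (`…CountertermJacksonRemainderCert`, p557810) VERBATIM —
  `hr : ContDiff ℝ 4 u_K`, `hlev : ∀ ϑ, |freeBandFn (klFermiPoint ν K ϑ) − ν| ≤ A₀` (`cmax ≥ A₀`),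
  `hjet : ∀ ϑ, ∀ j ≤ 4, |iteratedDeriv j u_K ϑ − iteratedDeriv j (bandFermiRadius (freeBandFn (klFermiPoint ν K ϑ))) ϑ| ≤ δ j`
  (`δ 0 ≥ 0` arbitrary — order 0 is exact; `δ 1 … δ 4` dominating the closed forms);
* §4 `frame_jets_sub_shiftedFree_le_of_polarJets` — fed by `FreeBandPolarJets a b T` (`U₀ = T.umax`, `R_k = T.R_k`; tables `KlwjCertA/B/C/X`).
Numerals [paper; seat script `g8/shifted_widths.py`, window B = `[-1.1, -0.1]`, `A₁ = … = A₄ = η`]: `W₁ ≈ 14.1η`, `W₂ ≈ 1.2·10³η`,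
`W₃ ≈ 1.44·10⁵η`, `W₄ ≈ 2.3·10⁷η`; sensitivities `∂W₄/∂(A₁, A₂, A₃, A₄) ≈ (2.0·10⁷, 2.4·10⁶, 1.9·10⁵, 9.4·10³)`; k3c3-p1's box
`δ = (·, 5·10⁻³, 0.05, 0.5, 10)` is met for `η ≤ 4.3·10⁻⁷` (window C: `1.1·10⁻⁶`).  Everything is PROVED; no definitions; nothing about
the Hubbard model beyond the free band.  References: BGM 2006 §2.4 Lemma 2.1 (2.40) [cite: BenfattoGiulianiMastropietro2006].
-/

noncomputable section

namespace Summit.HubbardSuperconductivity.HubbardSuperconductivity.Theorems.PerturbedFermiCurve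

set_option linter.dupNamespace false -- summit = problem name (single-conjunct summit), D-0017
set_option maxSynthPendingDepth 4 -- nested operator-norm instances (up to fourth Fréchet derivatives)

open Real Set
open Literature.MathematicalPhysics.QuantumLattice Literature.MathematicalPhysics.QuantumLattice.BandSectorCounting
open Summit.HubbardSuperconductivity.HubbardSuperconductivity.Theorems.DispersionFlow
open Summit.HubbardSuperconductivity.HubbardSuperconductivity.Theorems.KLRegimeSplit

section Frame

variable {a b : ℝ} (B : BandBounds a b) {K : TrigPolyC4v} {A₀ A₁ A₂ A₃ A₄ : ℝ}
  (hA₀ : ∀ p : Momentum, ‖iteratedFDeriv ℝ 0 (frameShift K) p‖ ≤ A₀)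
  (hA₁ : ∀ p : Momentum, ‖iteratedFDeriv ℝ 1 (frameShift K) p‖ ≤ A₁)
  (hA₂ : ∀ p : Momentum, ‖iteratedFDeriv ℝ 2 (frameShift K) p‖ ≤ A₂)
  (hA₃ : ∀ p : Momentum, ‖iteratedFDeriv ℝ 3 (frameShift K) p‖ ≤ A₃)
  (hA₄ : ∀ p : Momentum, ‖iteratedFDeriv ℝ 4 (frameShift K) p‖ ≤ A₄)
  (hA₁Dt : 2 * A₁ < B.Dtmin) {ν : ℝ} (hlo : a ≤ ν - A₀) (hhi : ν + A₀ ≤ b)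

/-! ## §3 The packaged SHIFTED-LEVEL tower on a level window, and the consumer's `iteratedDeriv` shape -/

include B hA₀ hA₁ hA₂ hA₃ hA₄ hA₁Dt hlo hhi in
/-- **THE FRAME'S TOWER AGAINST THE FREE RADIUS AT THE SHIFTED LEVEL, on a level window.**  Inputs: the FREE band's numbers on
`[a, b]` (`u ≤ U₀`, `|u^{(k)}| ≤ R_k`, `k = 1 … 4`, every level, every angle — the certified window table or any proved bounds), the
frame's per-order sizes `A₀ … A₄` (`2A₁ < Dt_min`, level `ν` with margins `A₀` inside `[a, b]`) and numbers `W₁ … W₄` dominating the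
closed forms of §2 at `R_k′ = R_k + W_k` (each LINEAR in `(A₁, …, A_k, W_1, …, W_{k−1})`; NO `A₀`).  Outputs at every angle `θ`, with
`ν′ = ν − δ_K(u_K(θ)·dir θ)`: `ν′ ∈ [ν − A₀, ν + A₀]`, `ν′ ∈ [a, b]`, **`u_K(θ) = u_{ν′}(θ)`**, `|u_K^{(k)}(θ) − u_{ν′}^{(k)}(θ)| ≤ W_k`
and the frame's own tower `|u_K^{(k)}(θ)| ≤ R_k + W_k` (`k = 1 … 4`). [cite: BenfattoGiulianiMastropietro2006, §2.4 Lemma 2.1 (2.40)] -/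
theorem frame_shifted_tower_of_window {U₀ R₁ R₂ R₃ R₄ W₁ W₂ W₃ W₄ : ℝ}
    (hU₀ : ∀ μ ∈ Icc a b, ∀ θ : ℝ, bandFermiRadius μ θ ≤ U₀)
    (hR₁ : ∀ μ ∈ Icc a b, ∀ θ : ℝ, |deriv (bandFermiRadius μ) θ| ≤ R₁)
    (hR₂ : ∀ μ ∈ Icc a b, ∀ θ : ℝ, |deriv (deriv (bandFermiRadius μ)) θ| ≤ R₂)
    (hR₃ : ∀ μ ∈ Icc a b, ∀ θ : ℝ, |deriv (deriv (deriv (bandFermiRadius μ))) θ| ≤ R₃)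
    (hR₄ : ∀ μ ∈ Icc a b, ∀ θ : ℝ, |deriv (deriv (deriv (deriv (bandFermiRadius μ)))) θ| ≤ R₄)
    (hW₁ : (U₀ + R₁) * (2 * A₁) / (B.Dtmin - 2 * A₁) ≤ W₁)
    (hW₂ : (4 * A₂ * ((R₁ + W₁) + U₀) ^ 2 + 8 * ((R₁ + W₁) + U₀) * W₁ + 2 * A₁ * (2 * (R₁ + W₁) + U₀) + 8 * W₁ +
        (R₂ + U₀) * (2 * A₁)) / (B.Dtmin - 2 * A₁) ≤ W₂)
    (hW₃ : (8 * A₃ * ((R₁ + W₁) + U₀) ^ 3 + 12 * W₁ * ((R₁ + W₁) + U₀) ^ 2 +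
        3 * (4 * A₂ * ((R₁ + W₁) + U₀) * ((R₂ + W₂) + 2 * (R₁ + W₁) + U₀) +
          4 * ((W₂ + 2 * W₁) * ((R₁ + W₁) + U₀) + ((R₂ + W₂) + 2 * (R₁ + W₁) + U₀) * W₁)) +
        2 * A₁ * (3 * (R₂ + W₂) + 3 * (R₁ + W₁) + U₀) + 4 * (3 * W₂ + 3 * W₁) + R₃ * (2 * A₁)) / (B.Dtmin - 2 * A₁) ≤ W₃)
    (hW₄ : (16 * A₄ * ((R₁ + W₁) + U₀) ^ 4 + 16 * W₁ * ((R₁ + W₁) + U₀) ^ 3 +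
        6 * (8 * A₃ * ((R₁ + W₁) + U₀) ^ 2 * ((R₂ + W₂) + 2 * (R₁ + W₁) + U₀) +
          4 * ((W₂ + 2 * W₁) * ((R₁ + W₁) + U₀) ^ 2 + 2 * ((R₁ + W₁) + U₀) * ((R₂ + W₂) + 2 * (R₁ + W₁) + U₀) * W₁)) +
        3 * (4 * A₂ * ((R₂ + W₂) + 2 * (R₁ + W₁) + U₀) ^ 2 + 8 * ((R₂ + W₂) + 2 * (R₁ + W₁) + U₀) * (W₂ + 2 * W₁)) +
        4 * (4 * A₂ * ((R₁ + W₁) + U₀) * ((R₃ + W₃) + 3 * (R₁ + W₁) + 3 * (R₂ + W₂) + U₀) +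
          4 * (W₁ * ((R₃ + W₃) + 3 * (R₁ + W₁) + 3 * (R₂ + W₂) + U₀) + ((R₁ + W₁) + U₀) * (W₃ + 3 * W₁ + 3 * W₂))) +
        2 * A₁ * (6 * (R₂ + W₂) + 4 * (R₃ + W₃) + 4 * (R₁ + W₁) + U₀) + 4 * (6 * W₂ + 4 * W₃ + 4 * W₁) + R₄ * (2 * A₁)) /
        (B.Dtmin - 2 * A₁) ≤ W₄)
    (θ : ℝ) :
    ν - (fun q : Fin 2 → ℝ => -K.eval q) (perturbedFermiRadius (fun p : Fin 2 → ℝ => -K.eval p) ν θ • dir θ) ∈ Icc (ν - A₀) (ν + A₀) ∧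
    ν - (fun q : Fin 2 → ℝ => -K.eval q) (perturbedFermiRadius (fun p : Fin 2 → ℝ => -K.eval p) ν θ • dir θ) ∈ Icc a b ∧
    perturbedFermiRadius (fun p : Fin 2 → ℝ => -K.eval p) ν θ =
      bandFermiRadius (ν - (fun q : Fin 2 → ℝ => -K.eval q) (perturbedFermiRadius (fun p : Fin 2 → ℝ => -K.eval p) ν θ • dir θ)) θ ∧
    |deriv (perturbedFermiRadius (fun p : Fin 2 → ℝ => -K.eval p) ν) θ -
        deriv (bandFermiRadius (ν - (fun q : Fin 2 → ℝ => -K.eval q)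
          (perturbedFermiRadius (fun p : Fin 2 → ℝ => -K.eval p) ν θ • dir θ))) θ| ≤ W₁ ∧
    |deriv (deriv (perturbedFermiRadius (fun p : Fin 2 → ℝ => -K.eval p) ν)) θ -
        deriv (deriv (bandFermiRadius (ν - (fun q : Fin 2 → ℝ => -K.eval q)
          (perturbedFermiRadius (fun p : Fin 2 → ℝ => -K.eval p) ν θ • dir θ)))) θ| ≤ W₂ ∧
    |deriv (deriv (deriv (perturbedFermiRadius (fun p : Fin 2 → ℝ => -K.eval p) ν))) θ -
        deriv (deriv (deriv (bandFermiRadius (ν - (fun q : Fin 2 → ℝ => -K.eval q)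
          (perturbedFermiRadius (fun p : Fin 2 → ℝ => -K.eval p) ν θ • dir θ))))) θ| ≤ W₃ ∧
    |deriv (deriv (deriv (deriv (perturbedFermiRadius (fun p : Fin 2 → ℝ => -K.eval p) ν)))) θ -
        deriv (deriv (deriv (deriv (bandFermiRadius (ν - (fun q : Fin 2 → ℝ => -K.eval q)
          (perturbedFermiRadius (fun p : Fin 2 → ℝ => -K.eval p) ν θ • dir θ)))))) θ| ≤ W₄ ∧
    |deriv (perturbedFermiRadius (fun p : Fin 2 → ℝ => -K.eval p) ν) θ| ≤ R₁ + W₁ ∧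
    |deriv (deriv (perturbedFermiRadius (fun p : Fin 2 → ℝ => -K.eval p) ν)) θ| ≤ R₂ + W₂ ∧
    |deriv (deriv (deriv (perturbedFermiRadius (fun p : Fin 2 → ℝ => -K.eval p) ν))) θ| ≤ R₃ + W₃ ∧
    |deriv (deriv (deriv (deriv (perturbedFermiRadius (fun p : Fin 2 → ℝ => -K.eval p) ν)))) θ| ≤ R₄ + W₄ := by
  have hm := frameShiftedLevel_mem_Icc_margin hA₀ (ν := ν) (perturbedFermiRadius (fun p : Fin 2 → ℝ => -K.eval p) ν θ • dir θ)
  have hν' := frameShiftedLevel_mem_Icc B hA₀ hlo hhi θ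
  have hvu := frameRadius_eq_bandFermiRadius_shiftedLevel B hA₀ hlo hhi θ
  set ν' := ν - (fun q : Fin 2 → ℝ => -K.eval q) (perturbedFermiRadius (fun p : Fin 2 → ℝ => -K.eval p) ν θ • dir θ) with hν'def
  clear_value ν'
  have u0 := hU₀ ν' hν' θ
  have f1 := hR₁ ν' hν' θ
  have d1 := (abs_deriv_frameRadius_sub_shifted_le B hA₀ hA₁ hA₁Dt hlo hhi hν' hvu u0 f1).trans hW₁
  have W1nn : 0 ≤ W₁ := (abs_nonneg _).trans d1
  have f1w : |deriv (bandFermiRadius ν') θ| ≤ R₁ + W₁ := f1.trans (le_add_of_nonneg_right W1nn)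
  have r1 := abs_le_add_of_abs_sub_le f1 d1
  have f2 := hR₂ ν' hν' θ
  have d2 := (abs_deriv_two_frameRadius_sub_shifted_le B hA₀ hA₁ hA₂ hA₁Dt hlo hhi hν' hvu u0 f1w r1 f2 d1).trans hW₂
  have W2nn : 0 ≤ W₂ := (abs_nonneg _).trans d2
  have f2w : |deriv (deriv (bandFermiRadius ν')) θ| ≤ R₂ + W₂ := f2.trans (le_add_of_nonneg_right W2nn)
  have r2 := abs_le_add_of_abs_sub_le f2 d2
  have f3 := hR₃ ν' hν' θ
  have d3 := (abs_deriv_three_frameRadius_sub_shifted_le B hA₀ hA₁ hA₂ hA₃ hA₁Dt hlo hhi hν' hvu u0 f1w r1 f2w r2 f3 d1 d2).trans hW₃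
  have W3nn : 0 ≤ W₃ := (abs_nonneg _).trans d3
  have f3w : |deriv (deriv (deriv (bandFermiRadius ν'))) θ| ≤ R₃ + W₃ := f3.trans (le_add_of_nonneg_right W3nn)
  have r3 := abs_le_add_of_abs_sub_le f3 d3
  have f4 := hR₄ ν' hν' θ
  have d4 := (abs_deriv_four_frameRadius_sub_shifted_le B hA₀ hA₁ hA₂ hA₃ hA₄ hA₁Dt hlo hhi hν' hvu u0 f1w r1 f2w r2 f3w r3 f4
    d1 d2 d3).trans hW₄
  have r4 := abs_le_add_of_abs_sub_le f4 d4
  exact ⟨hm, hν', hvu, d1, d2, d3, d4, r1, r2, r3, r4⟩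

include B hA₀ hlo hhi in
/-- **The shifted level in the consumer's vocabulary**: `freeBandFn (klFermiPoint ν K ϑ) = ν − δ_K(u_K(ϑ)·dir ϑ)` (`= ν + K(k_F^K ϑ)`). -/
theorem freeBandFn_klFermiPoint_eq_shiftedLevel (ϑ : ℝ) :
    freeBandFn (klFermiPoint ν K ϑ) =
      ν - (fun q : Fin 2 → ℝ => -K.eval q) (perturbedFermiRadius (fun p : Fin 2 → ℝ => -K.eval p) ν ϑ • dir ϑ) := by
  have h := sqDispersion_add_perturbedFermiRadius B (contDiff_four_negEval (K := K)).continuous (fun k _ => abs_negEval_le hA₀ k)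
    hlo hhi ϑ
  change sqDispersion (perturbedFermiRadius (fun p : Fin 2 → ℝ => -K.eval p) ν ϑ • dir ϑ) = _
  linarith

include B hA₀ hlo hhi in
/-- **`hlev`**: `|freeBandFn (klFermiPoint ν K ϑ) − ν| ≤ A₀` — the certificate's level shift `c` is bounded by the frame's order-0 size. -/
theorem abs_freeBandFn_klFermiPoint_sub_le (ϑ : ℝ) : |freeBandFn (klFermiPoint ν K ϑ) - ν| ≤ A₀ := by
  rw [freeBandFn_klFermiPoint_eq_shiftedLevel B hA₀ hlo hhi ϑ]; exact abs_frameShiftedLevel_sub_le hA₀ _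

include B hA₀ hA₁ hA₂ hA₃ hA₄ hA₁Dt hlo hhi in
/-- **THE CONSUMER SHAPE — the three analytic inputs `hr`, `hlev`, `hjet` of k3c3-p1's `flowPiece_reading_remainder_jets_of_cert`
(`…CountertermJacksonRemainderCert`, p557810) VERBATIM.**  Under the inputs of `frame_shifted_tower_of_window` (widths `W₁ … W₄`
dominating the closed forms) and ANY jet box `δ` with `0 ≤ δ 0`, `W_k ≤ δ k` (`k = 1 … 4`): `u_K ∈ C⁴`;
`∀ ϑ, |freeBandFn (klFermiPoint ν K ϑ) − ν| ≤ A₀` (so `cmax := A₀`, or any `cmax ≥ A₀`); and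
`∀ ϑ, ∀ j ≤ 4, |iteratedDeriv j u_K ϑ − iteratedDeriv j (bandFermiRadius (freeBandFn (klFermiPoint ν K ϑ))) ϑ| ≤ δ j`.
The widths are LINEAR in `A₁ … A₄` (no `A₀`): e.g. on the window `[-1.1, -0.1]` (table B) with `A₁ = … = A₄ = η`,
`W ≈ (14.1η, 1.2·10³η, 1.44·10⁵η, 2.3·10⁷η)` [paper]. [cite: BenfattoGiulianiMastropietro2006, §2.4 Lemma 2.1 (2.40)] -/
theorem frame_jets_sub_shiftedFree_le {U₀ R₁ R₂ R₃ R₄ W₁ W₂ W₃ W₄ : ℝ} {δ : ℕ → ℝ}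
    (hU₀ : ∀ μ ∈ Icc a b, ∀ θ : ℝ, bandFermiRadius μ θ ≤ U₀)
    (hR₁ : ∀ μ ∈ Icc a b, ∀ θ : ℝ, |deriv (bandFermiRadius μ) θ| ≤ R₁)
    (hR₂ : ∀ μ ∈ Icc a b, ∀ θ : ℝ, |deriv (deriv (bandFermiRadius μ)) θ| ≤ R₂)
    (hR₃ : ∀ μ ∈ Icc a b, ∀ θ : ℝ, |deriv (deriv (deriv (bandFermiRadius μ))) θ| ≤ R₃)
    (hR₄ : ∀ μ ∈ Icc a b, ∀ θ : ℝ, |deriv (deriv (deriv (deriv (bandFermiRadius μ)))) θ| ≤ R₄)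
    (hW₁ : (U₀ + R₁) * (2 * A₁) / (B.Dtmin - 2 * A₁) ≤ W₁)
    (hW₂ : (4 * A₂ * ((R₁ + W₁) + U₀) ^ 2 + 8 * ((R₁ + W₁) + U₀) * W₁ + 2 * A₁ * (2 * (R₁ + W₁) + U₀) + 8 * W₁ +
        (R₂ + U₀) * (2 * A₁)) / (B.Dtmin - 2 * A₁) ≤ W₂)
    (hW₃ : (8 * A₃ * ((R₁ + W₁) + U₀) ^ 3 + 12 * W₁ * ((R₁ + W₁) + U₀) ^ 2 +
        3 * (4 * A₂ * ((R₁ + W₁) + U₀) * ((R₂ + W₂) + 2 * (R₁ + W₁) + U₀) +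
          4 * ((W₂ + 2 * W₁) * ((R₁ + W₁) + U₀) + ((R₂ + W₂) + 2 * (R₁ + W₁) + U₀) * W₁)) +
        2 * A₁ * (3 * (R₂ + W₂) + 3 * (R₁ + W₁) + U₀) + 4 * (3 * W₂ + 3 * W₁) + R₃ * (2 * A₁)) / (B.Dtmin - 2 * A₁) ≤ W₃)
    (hW₄ : (16 * A₄ * ((R₁ + W₁) + U₀) ^ 4 + 16 * W₁ * ((R₁ + W₁) + U₀) ^ 3 +
        6 * (8 * A₃ * ((R₁ + W₁) + U₀) ^ 2 * ((R₂ + W₂) + 2 * (R₁ + W₁) + U₀) +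
          4 * ((W₂ + 2 * W₁) * ((R₁ + W₁) + U₀) ^ 2 + 2 * ((R₁ + W₁) + U₀) * ((R₂ + W₂) + 2 * (R₁ + W₁) + U₀) * W₁)) +
        3 * (4 * A₂ * ((R₂ + W₂) + 2 * (R₁ + W₁) + U₀) ^ 2 + 8 * ((R₂ + W₂) + 2 * (R₁ + W₁) + U₀) * (W₂ + 2 * W₁)) +
        4 * (4 * A₂ * ((R₁ + W₁) + U₀) * ((R₃ + W₃) + 3 * (R₁ + W₁) + 3 * (R₂ + W₂) + U₀) +
          4 * (W₁ * ((R₃ + W₃) + 3 * (R₁ + W₁) + 3 * (R₂ + W₂) + U₀) + ((R₁ + W₁) + U₀) * (W₃ + 3 * W₁ + 3 * W₂))) +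
        2 * A₁ * (6 * (R₂ + W₂) + 4 * (R₃ + W₃) + 4 * (R₁ + W₁) + U₀) + 4 * (6 * W₂ + 4 * W₃ + 4 * W₁) + R₄ * (2 * A₁)) /
        (B.Dtmin - 2 * A₁) ≤ W₄)
    (hδ0 : 0 ≤ δ 0) (hδ1 : W₁ ≤ δ 1) (hδ2 : W₂ ≤ δ 2) (hδ3 : W₃ ≤ δ 3) (hδ4 : W₄ ≤ δ 4) :
    ContDiff ℝ 4 (perturbedFermiRadius (fun p : Fin 2 → ℝ => -K.eval p) ν) ∧
    (∀ ϑ : ℝ, |freeBandFn (klFermiPoint ν K ϑ) - ν| ≤ A₀) ∧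
    (∀ ϑ : ℝ, ∀ j ≤ 4, |iteratedDeriv j (perturbedFermiRadius (fun p : Fin 2 → ℝ => -K.eval p) ν) ϑ -
      iteratedDeriv j (bandFermiRadius (freeBandFn (klFermiPoint ν K ϑ))) ϑ| ≤ δ j) := by
  refine ⟨contDiff_four_frameRadius B hA₀ hA₁ hA₁Dt hlo hhi, abs_freeBandFn_klFermiPoint_sub_le B hA₀ hlo hhi, fun ϑ j hj => ?_⟩
  obtain ⟨-, -, hvu, d1, d2, d3, d4, -, -, -, -⟩ :=
    frame_shifted_tower_of_window B hA₀ hA₁ hA₂ hA₃ hA₄ hA₁Dt hlo hhi hU₀ hR₁ hR₂ hR₃ hR₄ hW₁ hW₂ hW₃ hW₄ ϑ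
  rw [freeBandFn_klFermiPoint_eq_shiftedLevel B hA₀ hlo hhi ϑ]
  -- `iteratedDeriv j = deriv ∘ … ∘ deriv` (the lineage's nested convention), order by order
  interval_cases j
  · rw [iteratedDeriv_zero, iteratedDeriv_zero, ← hvu, sub_self, abs_zero]; exact hδ0
  · rw [iteratedDeriv_one, iteratedDeriv_one]; exact d1.trans hδ1
  · simp only [iteratedDeriv_succ, iteratedDeriv_zero]; exact d2.trans hδ2
  · simp only [iteratedDeriv_succ, iteratedDeriv_zero]; exact d3.trans hδ3
  · simp only [iteratedDeriv_succ, iteratedDeriv_zero]; exact d4.trans hδ4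

end Frame

/-! ## §4 Fed by a polar-jet table (`FreeBandPolarJets a b T`) -/

section Bridge

variable {a b : ℝ} {T : PolarJetTable}

set_option maxSynthPendingDepth 4 in -- nested operator-norm instances (fourth Fréchet derivatives of the frame)
/-- **The consumer shape fed by a polar-jet table**: `frame_jets_sub_shiftedFree_le` with `U₀ = T.umax`, `R_k = T.R_k` from
`FreeBandPolarJets a b T` (the certified tables `KlwjCertA/B/C/X`, carried as hypotheses — KLCert pattern). -/
theorem frame_jets_sub_shiftedFree_le_of_polarJets (h : FreeBandPolarJets a b T) (B : BandBounds a b) {K : TrigPolyC4v}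
    {A₀ A₁ A₂ A₃ A₄ : ℝ}
    (hA₀ : ∀ p : Momentum, ‖iteratedFDeriv ℝ 0 (frameShift K) p‖ ≤ A₀)
    (hA₁ : ∀ p : Momentum, ‖iteratedFDeriv ℝ 1 (frameShift K) p‖ ≤ A₁)
    (hA₂ : ∀ p : Momentum, ‖iteratedFDeriv ℝ 2 (frameShift K) p‖ ≤ A₂)
    (hA₃ : ∀ p : Momentum, ‖iteratedFDeriv ℝ 3 (frameShift K) p‖ ≤ A₃)
    (hA₄ : ∀ p : Momentum, ‖iteratedFDeriv ℝ 4 (frameShift K) p‖ ≤ A₄)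
    (hA₁Dt : 2 * A₁ < B.Dtmin) {ν : ℝ} (hlo : a ≤ ν - A₀) (hhi : ν + A₀ ≤ b) {W₁ W₂ W₃ W₄ : ℝ} {δ : ℕ → ℝ}
    (hW₁ : (T.umax + T.R1) * (2 * A₁) / (B.Dtmin - 2 * A₁) ≤ W₁)
    (hW₂ : (4 * A₂ * ((T.R1 + W₁) + T.umax) ^ 2 + 8 * ((T.R1 + W₁) + T.umax) * W₁ + 2 * A₁ * (2 * (T.R1 + W₁) + T.umax) +
        8 * W₁ + (T.R2 + T.umax) * (2 * A₁)) / (B.Dtmin - 2 * A₁) ≤ W₂)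
    (hW₃ : (8 * A₃ * ((T.R1 + W₁) + T.umax) ^ 3 + 12 * W₁ * ((T.R1 + W₁) + T.umax) ^ 2 +
        3 * (4 * A₂ * ((T.R1 + W₁) + T.umax) * ((T.R2 + W₂) + 2 * (T.R1 + W₁) + T.umax) +
          4 * ((W₂ + 2 * W₁) * ((T.R1 + W₁) + T.umax) + ((T.R2 + W₂) + 2 * (T.R1 + W₁) + T.umax) * W₁)) +
        2 * A₁ * (3 * (T.R2 + W₂) + 3 * (T.R1 + W₁) + T.umax) + 4 * (3 * W₂ + 3 * W₁) + T.R3 * (2 * A₁)) /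
        (B.Dtmin - 2 * A₁) ≤ W₃)
    (hW₄ : (16 * A₄ * ((T.R1 + W₁) + T.umax) ^ 4 + 16 * W₁ * ((T.R1 + W₁) + T.umax) ^ 3 +
        6 * (8 * A₃ * ((T.R1 + W₁) + T.umax) ^ 2 * ((T.R2 + W₂) + 2 * (T.R1 + W₁) + T.umax) +
          4 * ((W₂ + 2 * W₁) * ((T.R1 + W₁) + T.umax) ^ 2 +
            2 * ((T.R1 + W₁) + T.umax) * ((T.R2 + W₂) + 2 * (T.R1 + W₁) + T.umax) * W₁)) +
        3 * (4 * A₂ * ((T.R2 + W₂) + 2 * (T.R1 + W₁) + T.umax) ^ 2 +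
          8 * ((T.R2 + W₂) + 2 * (T.R1 + W₁) + T.umax) * (W₂ + 2 * W₁)) +
        4 * (4 * A₂ * ((T.R1 + W₁) + T.umax) * ((T.R3 + W₃) + 3 * (T.R1 + W₁) + 3 * (T.R2 + W₂) + T.umax) +
          4 * (W₁ * ((T.R3 + W₃) + 3 * (T.R1 + W₁) + 3 * (T.R2 + W₂) + T.umax) +
            ((T.R1 + W₁) + T.umax) * (W₃ + 3 * W₁ + 3 * W₂))) +
        2 * A₁ * (6 * (T.R2 + W₂) + 4 * (T.R3 + W₃) + 4 * (T.R1 + W₁) + T.umax) + 4 * (6 * W₂ + 4 * W₃ + 4 * W₁) +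
        T.R4 * (2 * A₁)) / (B.Dtmin - 2 * A₁) ≤ W₄)
    (hδ0 : 0 ≤ δ 0) (hδ1 : W₁ ≤ δ 1) (hδ2 : W₂ ≤ δ 2) (hδ3 : W₃ ≤ δ 3) (hδ4 : W₄ ≤ δ 4) :
    ContDiff ℝ 4 (perturbedFermiRadius (fun p : Fin 2 → ℝ => -K.eval p) ν) ∧
    (∀ ϑ : ℝ, |freeBandFn (klFermiPoint ν K ϑ) - ν| ≤ A₀) ∧
    (∀ ϑ : ℝ, ∀ j ≤ 4, |iteratedDeriv j (perturbedFermiRadius (fun p : Fin 2 → ℝ => -K.eval p) ν) ϑ -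
      iteratedDeriv j (bandFermiRadius (freeBandFn (klFermiPoint ν K ϑ))) ϑ| ≤ δ j) :=
  frame_jets_sub_shiftedFree_le B hA₀ hA₁ hA₂ hA₃ hA₄ hA₁Dt hlo hhi h.le_umax h.abs_deriv_le h.abs_deriv_two_le h.abs_deriv_three_le
    h.abs_deriv_four_le hW₁ hW₂ hW₃ hW₄ hδ0 hδ1 hδ2 hδ3 hδ4

end Bridge

end Summit.HubbardSuperconductivity.HubbardSuperconductivity.Theorems.PerturbedFermiCurve

end
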